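import Mathlib
import Summits.MatrixMultiplication.MatrixMultiplication.Theses.FidelityWitnesses
import Summits.MatrixMultiplication.MatrixMultiplication.Theorems.FidelityWitnessesDiagonalPowerDecayExactnessIJ
import Summits.MatrixMultiplication.MatrixMultiplication.Theorems.FidelityWitnessesDiagonalPowerDecayPointLawCore

/-!
# The exactness principle, parameter-free: `stub_exactnessIJ ⟺ M(n,n²) ≤ n^{6/ω(ℂ)}` (companion to …PointLawCore.lean)

Line `vertex-flattening-factor-rank` for the crux `FidelityWitnesses.DiagonalPowerDecay`
(`stmt-MatrixMultiplication-14053`), lead c2.  One-line corollaries joining the two landed files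
`…DiagonalPowerDecayExactnessIJ.lean` (`stub_exactnessIJ ⟺ CaptureLaw`, `CaptureLaw` from `ω(ℂ) = 2`) and
`…DiagonalPowerDecayPointLawCore.lean` (`PointLaw ⟺ CaptureLaw`):

* `exactnessIJ_iff_pointLaw` (registered sub-goal) — the line's open ω-free stub IS the POINT LAW
  `∀ n S, R(S) ≤ n² → |⟨S,⟨n,n,n⟩⟩|² ≤ n^{6/ω(ℂ)}·‖S‖²` ("`M(n,n²) ≤ n^{6/ω}`", no constant, no `ε`).
* `pointLaw_of_omega_eq_two`, `pointLaw_of_matrixMultiplication`, `pointLaw_of_not_fidelityThesis` — the point law holds if `ω(ℂ) = 2`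
  (Cauchy–Schwarz, `n^{6/2} = n³`), hence under the summit and under any failure of the route target: it is irrefutable short of `ω > 2`.
-/

set_option linter.dupNamespace false

namespace Summit.MatrixMultiplication.MatrixMultiplication.Theorems.DiagonalPowerDecay

open scoped BigOperators
open Literature.Computability.AlgebraicComplexity
open Summit.MatrixMultiplication.MatrixMultiplication.Theses.FidelityWitnesses (DiagonalPowerDecay FidelityThesis)

/-- **The line's open stub `stub_exactnessIJ` is the POINT LAW `M(n,n²) ≤ n^{6/ω(ℂ)}`** — no constant, no `ε`:
`(∀ε ∃C ∀n S, … ∃ I J, …) ↔ (∀ n S, R(S) ≤ n² → |⟨S,⟨n,n,n⟩⟩|² ≤ n^{6/ω}‖S‖²)`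
(`exactnessIJ_iff_captureLaw` then `pointLaw_iff_captureLaw`). [folklore] -/
theorem exactnessIJ_iff_pointLaw :
    (∀ ε : ℝ, 0 < ε → ∃ C : ℝ, 0 < C ∧ ∀ n : ℕ, 1 ≤ n →
      ∀ S : (Fin n × Fin n) → (Fin n × Fin n) → (Fin n × Fin n) → ℂ, tensorRank S ≤ n ^ 2 →
        ∃ I J : Finset (Fin n × Fin n),
          tensorRank (partialMatMulTensor ℂ n n n I J) ≤ n ^ 2 ∧
          ‖∑ a, ∑ b, ∑ c, S a b c * matMulTensor ℂ n n n a b c‖ ^ 2 ≤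
            C * (n : ℝ) ^ ε * (filling n n n I J : ℝ) * ∑ a, ∑ b, ∑ c, ‖S a b c‖ ^ 2) ↔
    (∀ n : ℕ, ∀ S : (Fin n × Fin n) → (Fin n × Fin n) → (Fin n × Fin n) → ℂ, tensorRank S ≤ n ^ 2 →
      ‖∑ a, ∑ b, ∑ c, S a b c * matMulTensor ℂ n n n a b c‖ ^ 2 ≤
        (n : ℝ) ^ (6 / omega ℂ) * ∑ a, ∑ b, ∑ c, ‖S a b c‖ ^ 2) :=
  exactnessIJ_iff_captureLaw.trans pointLaw_iff_captureLaw.symm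

/-- **If `ω(ℂ) = 2` the point law holds** (the capture law is then Cauchy–Schwarz, `captureLaw_of_omega_eq_two`; transfer by
`pointLaw_of_captureLaw`). [folklore] -/
theorem pointLaw_of_omega_eq_two (hω : omega ℂ = 2) :
    ∀ n : ℕ, ∀ S : (Fin n × Fin n) → (Fin n × Fin n) → (Fin n × Fin n) → ℂ, tensorRank S ≤ n ^ 2 →
      ‖∑ a, ∑ b, ∑ c, S a b c * matMulTensor ℂ n n n a b c‖ ^ 2 ≤
        (n : ℝ) ^ (6 / omega ℂ) * ∑ a, ∑ b, ∑ c, ‖S a b c‖ ^ 2 :=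
  pointLaw_of_captureLaw (captureLaw_of_omega_eq_two hω)

/-- **The summit implies the point law** (`MatrixMultiplication ↔ ω(ℂ) = 2`). [folklore] -/
theorem pointLaw_of_matrixMultiplication (hM : _root_.MatrixMultiplication) :
    ∀ n : ℕ, ∀ S : (Fin n × Fin n) → (Fin n × Fin n) → (Fin n × Fin n) → ℂ, tensorRank S ≤ n ^ 2 →
      ‖∑ a, ∑ b, ∑ c, S a b c * matMulTensor ℂ n n n a b c‖ ^ 2 ≤
        (n : ℝ) ^ (6 / omega ℂ) * ∑ a, ∑ b, ∑ c, ‖S a b c‖ ^ 2 :=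
  pointLaw_of_omega_eq_two (_root_.MatrixMultiplication_iff.1 hM)

/-- **A failure of the route target implies the point law** (`¬FidelityThesis ⟹ ω(ℂ) = 2`): together with
`dpd_of_pointLaw_of_two_lt_omega` (…PointLawCore.lean), the crux `DiagonalPowerDecay` is EXACTLY `FidelityThesis ∧ PointLaw` away —
`FidelityThesis ∧ PointLaw ⟹ DiagonalPowerDecay ⟹ FidelityThesis`, and `PointLaw` fails only in a world where `FidelityThesis` holds.
[folklore] -/
theorem pointLaw_of_not_fidelityThesis (hX : ¬ FidelityThesis) :
    ∀ n : ℕ, ∀ S : (Fin n × Fin n) → (Fin n × Fin n) → (Fin n × Fin n) → ℂ, tensorRank S ≤ n ^ 2 →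
      ‖∑ a, ∑ b, ∑ c, S a b c * matMulTensor ℂ n n n a b c‖ ^ 2 ≤
        (n : ℝ) ^ (6 / omega ℂ) * ∑ a, ∑ b, ∑ c, ‖S a b c‖ ^ 2 :=
  pointLaw_of_omega_eq_two
    (Summit.MatrixMultiplication.MatrixMultiplication.Theorems.omega_eq_two_of_not_fidelityThesis hX)

end Summit.MatrixMultiplication.MatrixMultiplication.Theorems.DiagonalPowerDecay
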